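import Literature.Computability.AlgebraicComplexity.AsymptoticSpectrum
import HarnessLib

/-!
# Relative exponents, irreversibility and monomial restriction (Christandl–Vrana–Zuiddam 2021)

Topic `Literature/Computability/AlgebraicComplexity`, next to `AsymptoticSpectrum.lean` (whose
`kroneckerPow`, `TensorRestrictsTo`, `unitTensor` are used). General notions of
M. Christandl, P. Vrana, J. Zuiddam, *Barriers for fast matrix multiplication from
irreversibility*, Theory of Computing 17 (2021), art. 2 = arXiv:1812.06952 (**arXiv numbering**:
Def. 2 and Prop. 3 p. 5, Def. 4 and Def. 6 p. 5, §2.4 p. 8), split off from the barrier file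
`Literature/Barriers/MatrixMultiplication/IrreversibilityBarrier.lean` (review of p6795, item 5) so
that other files on relative exponents / monomial restriction can import them.

## Content

* `restrictionCost t s n = min {m ∈ ℕ | t^{⊗m} ≥ s^{⊗n}}` and the **relative exponent**
  `relativeExponent t s = ω(t,s) = lim_n n⁻¹ · min {m | t^{⊗m} ≥ s^{⊗n}}` (CVZ Def. 2), formalised as
  the infimum over `n ≥ 1` (see "wording risks"); `≥` is `TensorRestrictsTo`, powers are
  `kroneckerPow`.
* `irreversibility t = i(t) = ω(⟨2⟩,t) · ω(t,⟨2⟩)` (CVZ Def. 4), `⟨2⟩ = unitTensor K 2`.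
* Monomial variants (CVZ §2.4): `IsGenSubperm` (generalised sub-permutation matrices),
  `TensorMonRestrictsTo` (`t ≥_M s`), `monRestrictionCost`, `monRelativeExponent` (`ω_M(t,s)`),
  `monIrreversibility` (`i_M(t) = ω(⟨2⟩,t) · ω_M(t,⟨2⟩)`).
* Proved API: `restrictionCost_le`, `restrictionCost_self_le`, `relativeExponent_nonneg`,
  `relativeExponent_bddBelow`, `relativeExponent_le_div`, `relativeExponent_self_le_one`
  (`ω(t,t) ≤ 1`, half of Prop. 3), `irreversibility_nonneg`, `isGenSubperm_zero/one`,
  `TensorMonRestrictsTo.tensorRestrictsTo/refl`, `monRelativeExponent_nonneg`,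
  `monRestrictionCost_le/_self_le`, `monRelativeExponent_bddBelow/_le_div/_self_le_one`,
  `relativeExponent_le_div_of_mon`, `restrictionCost_le_monRestrictionCost` (pointwise `ω ≤ ω_M`,
  Prop. 7), `monIrreversibility_nonneg`.

## Design choices and wording risks

* CVZ work over "some fixed but arbitrary field `F`" (§2.1); the definitions are stated over a
  commutative semiring `K` and arbitrary (finite source) index types, as in `AsymptoticSpectrum.lean`.
* **`lim` versus `sup`/`inf` in Def. 2.** CVZ define `ω(t,s)` as the LIMIT of `n⁻¹ f(n)`,
  `f(n) := min {m | t^{⊗m} ≥ s^{⊗n}}`, adding "= sup_n n⁻¹ f(n) … by Fekete's lemma". Since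
  restrictions multiply under `⊗`, `f` is subadditive and Fekete's lemma identifies the limit with
  the INFIMUM `inf_n n⁻¹ f(n)`; this is also what the paper's identities `ω(⟨2⟩,t) = log₂ R̃(t)`
  (`R̃ = inf_n R(t^{⊗n})^{1/n}`) and `ω(t,t) = 1` require (for `t = ⟨2,2,2⟩`, `f(1) = ⌈log₂ 7⌉ = 3`
  exceeds the limit `ω`). We therefore formalise the printed limit as `⨅ n, f(n+1)/(n+1)`.
* **Junk values.** `restrictionCost`/`monRestrictionCost` are `Nat.sInf` (`0` on the empty set), so
  where the paper's `min ∅ = ∞` makes `ω(t,s) = ∞` (no power of `t` restricts to a power of `s`: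
  e.g. `ω(t,⟨2⟩)` for `Q̃(t) = 1`, or `ω_M(⟨2⟩, ⟨2,2,2⟩)`, a monomial restriction of a power of a unit
  tensor having at most one nonzero entry per slice) the Lean value is the junk `0`, and so are
  `i(t)`, `i_M(t)` built from it. Users state the finiteness hypotheses they need explicitly
  (`∃ m, TensorRestrictsTo (kroneckerPow t m) s`, resp. `TensorMonRestrictsTo`), under which every
  defining set is nonempty (restrictions and monomial restrictions multiply under `⊗`) and the
  infimum is the printed limit; see `IrreversibilityBarrier.lean` for this discipline.
-/

noncomputable section

open scoped BigOperators

namespace Literature.Computability.AlgebraicComplexity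

universe u

/-! ## Relative exponent and irreversibility (CVZ Def. 2, Def. 4) -/

section RelativeExponent

variable {K : Type u} [CommSemiring K]
variable {ι κ μ ι' κ' μ' : Type*} [Fintype ι] [Fintype κ] [Fintype μ]

/-- `min {m ∈ ℕ | t^{⊗m} ≥ s^{⊗n}}`, the inner minimum of CVZ Def. 2 (`≥` = restriction,
`TensorRestrictsTo`; powers = `kroneckerPow`). `Nat.sInf`: junk `0` if no power of `t` restricts to
`s^{⊗n}`. [cite: ChristandlVranaZuiddam2021, Def. 2] -/
def restrictionCost (t : ι → κ → μ → K) (s : ι' → κ' → μ' → K) (n : ℕ) : ℕ :=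
  sInf {m : ℕ | TensorRestrictsTo (kroneckerPow t m) (kroneckerPow s n)}

/-- A witness `t^{⊗m} ≥ s^{⊗n}` bounds the cost by `m`. [cite: ChristandlVranaZuiddam2021, Def. 2] -/
theorem restrictionCost_le {t : ι → κ → μ → K} {s : ι' → κ' → μ' → K} {n m : ℕ}
    (h : TensorRestrictsTo (kroneckerPow t m) (kroneckerPow s n)) : restrictionCost t s n ≤ m :=
  Nat.sInf_le h

/-- **Relative exponent** `ω(t, s) = lim_n n⁻¹ min {m ∈ ℕ | t^{⊗m} ≥ s^{⊗n}}` (CVZ Def. 2),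
formalised as the infimum over `n ≥ 1` of `n⁻¹ min {…}` — equal to the printed limit by Fekete's
lemma, the sequence of minima being subadditive (see the module docstring, "wording risks").
Real `iInf` over `n + 1`, `n : ℕ`, of nonnegative terms. [cite: ChristandlVranaZuiddam2021, Def. 2] -/
def relativeExponent (t : ι → κ → μ → K) (s : ι' → κ' → μ' → K) : ℝ :=
  ⨅ n : ℕ, (restrictionCost t s (n + 1) : ℝ) / ((n : ℝ) + 1)

/-- `t^{⊗n} ≥ t^{⊗n}`, so `min {m | t^{⊗m} ≥ t^{⊗n}} ≤ n` (towards `ω(t,t) = 1`, CVZ Prop. 3).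
[cite: ChristandlVranaZuiddam2021, Prop. 3] -/
theorem restrictionCost_self_le [DecidableEq ι] [DecidableEq κ] [DecidableEq μ]
    (t : ι → κ → μ → K) (n : ℕ) : restrictionCost t t n ≤ n :=
  restrictionCost_le (TensorRestrictsTo.refl _)

/-- `ω(t, s) ≥ 0`. [folklore] -/
theorem relativeExponent_nonneg (t : ι → κ → μ → K) (s : ι' → κ' → μ' → K) :
    0 ≤ relativeExponent t s :=
  Real.iInf_nonneg fun n => by positivity

/-- The terms of the infimum are bounded below (by `0`). [folklore] -/
theorem relativeExponent_bddBelow (t : ι → κ → μ → K) (s : ι' → κ' → μ' → K) :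
    BddBelow (Set.range fun n : ℕ => (restrictionCost t s (n + 1) : ℝ) / ((n : ℝ) + 1)) :=
  ⟨0, by rintro _ ⟨n, rfl⟩; positivity⟩

/-- `ω(t, s) ≤ m/n` for every witness `t^{⊗m} ≥ s^{⊗n}`, `n ≥ 1` (an upper bound on a relative
exponent is certified by a single restriction). [cite: ChristandlVranaZuiddam2021, Def. 2] -/
theorem relativeExponent_le_div {t : ι → κ → μ → K} {s : ι' → κ' → μ' → K} {n m : ℕ}
    (h : TensorRestrictsTo (kroneckerPow t m) (kroneckerPow s (n + 1))) :
    relativeExponent t s ≤ (m : ℝ) / ((n : ℝ) + 1) := by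
  refine (ciInf_le (relativeExponent_bddBelow t s) n).trans ?_
  have hpos : (0 : ℝ) < (n : ℝ) + 1 := by positivity
  exact div_le_div_of_nonneg_right (by exact_mod_cast restrictionCost_le h) hpos.le

/-- `ω(t, t) ≤ 1` (the easy half of CVZ Prop. 3, `ω(t,t) = 1`). [cite: ChristandlVranaZuiddam2021, Prop. 3] -/
theorem relativeExponent_self_le_one [DecidableEq ι] [DecidableEq κ] [DecidableEq μ]
    (t : ι → κ → μ → K) : relativeExponent t t ≤ 1 := by
  have h := relativeExponent_le_div (t := t) (s := t) (n := 0) (m := 1) (TensorRestrictsTo.refl _)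
  simpa using h

/-- **Irreversibility** `i(t) = ω(⟨2⟩, t) · ω(t, ⟨2⟩)` (CVZ Def. 4; equivalently
`log₂ R̃(t) / log₂ Q̃(t)`, eq. after Def. 4). `t` is *reversible* if `i(t) = 1` and *irreversible* if
`i(t) > 1` (Def. 6). [cite: ChristandlVranaZuiddam2021, Def. 4] -/
def irreversibility (t : ι → κ → μ → K) : ℝ :=
  relativeExponent (unitTensor K 2) t * relativeExponent t (unitTensor K 2)

/-- `i(t) ≥ 0` (trivial; CVZ Prop. 5 has the sharper `i(t) ≥ 1` under Assumption 1). [folklore] -/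
theorem irreversibility_nonneg (t : ι → κ → μ → K) : 0 ≤ irreversibility t :=
  mul_nonneg (relativeExponent_nonneg _ _) (relativeExponent_nonneg _ _)

end RelativeExponent

/-! ## Monomial restriction, `ω_M` and monomial irreversibility (CVZ §2.4) -/

section Monomial

variable {K : Type u} [CommSemiring K]
variable {ι κ μ ι' κ' μ' : Type*}

/-- A **generalised sub-permutation matrix** (CVZ §2.4): every row and every column has at most one
nonzero entry. [cite: ChristandlVranaZuiddam2021, §2.4] -/
def IsGenSubperm (A : ι' → ι → K) : Prop :=
  (∀ a' a₁ a₂, A a' a₁ ≠ 0 → A a' a₂ ≠ 0 → a₁ = a₂) ∧ (∀ a a'₁ a'₂, A a'₁ a ≠ 0 → A a'₂ a ≠ 0 → a'₁ = a'₂)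

/-- The zero matrix is a generalised sub-permutation matrix. [folklore] -/
theorem isGenSubperm_zero : IsGenSubperm (0 : ι' → ι → K) :=
  ⟨fun _ _ _ h _ => (h rfl).elim, fun _ _ _ h _ => (h rfl).elim⟩

/-- The identity matrix is a generalised sub-permutation matrix. [folklore] -/
theorem isGenSubperm_one [DecidableEq ι] :
    IsGenSubperm (fun a' a : ι => if a = a' then (1 : K) else 0) := by
  refine ⟨fun a' a₁ a₂ h₁ h₂ => ?_, fun a a'₁ a'₂ h₁ h₂ => ?_⟩
  · have e₁ : a₁ = a' := by by_contra h; exact h₁ (if_neg h)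
    have e₂ : a₂ = a' := by by_contra h; exact h₂ (if_neg h)
    rw [e₁, e₂]
  · have e₁ : a = a'₁ := by by_contra h; exact h₁ (if_neg h)
    have e₂ : a = a'₂ := by by_contra h; exact h₂ (if_neg h)
    rw [← e₁, ← e₂]

variable [Fintype ι] [Fintype κ] [Fintype μ]

/-- **Monomial restriction** `t ≥_M s` (CVZ §2.4, after Strassen 1987): `s = (A, B, C)·t` for linear
maps whose matrices in the standard bases are generalised sub-permutation matrices.
[cite: ChristandlVranaZuiddam2021, §2.4] -/
def TensorMonRestrictsTo (t : ι → κ → μ → K) (s : ι' → κ' → μ' → K) : Prop :=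
  ∃ (A : ι' → ι → K) (B : κ' → κ → K) (C : μ' → μ → K),
    IsGenSubperm A ∧ IsGenSubperm B ∧ IsGenSubperm C ∧
      ∀ a' b' c', s a' b' c' = ∑ a, ∑ b, ∑ c, A a' a * B b' b * C c' c * t a b c

/-- A monomial restriction is a restriction (CVZ Prop. 7: `ω_M(s,t) ≥ ω(s,t)` rests on this).
[cite: ChristandlVranaZuiddam2021, Prop. 7] -/
theorem TensorMonRestrictsTo.tensorRestrictsTo {t : ι → κ → μ → K} {s : ι' → κ' → μ' → K}
    (h : TensorMonRestrictsTo t s) : TensorRestrictsTo t s := by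
  obtain ⟨A, B, C, -, -, -, hs⟩ := h
  exact ⟨A, B, C, hs⟩

/-- `t ≥_M t` (identity matrices). [cite: ChristandlVranaZuiddam2021, Prop. 7] -/
theorem TensorMonRestrictsTo.refl [DecidableEq ι] [DecidableEq κ] [DecidableEq μ]
    (t : ι → κ → μ → K) : TensorMonRestrictsTo t t := by
  refine ⟨fun a' a => if a = a' then 1 else 0, fun b' b => if b = b' then 1 else 0,
    fun c' c => if c = c' then 1 else 0, isGenSubperm_one, isGenSubperm_one, isGenSubperm_one,
    fun a' b' c' => ?_⟩
  rw [Finset.sum_eq_single a' (fun a _ ha => by simp [ha]) (by simp),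
    Finset.sum_eq_single b' (fun b _ hb => by simp [hb]) (by simp),
    Finset.sum_eq_single c' (fun c _ hc => by simp [hc]) (by simp)]
  simp

/-- `min {m | t^{⊗m} ≥_M s^{⊗n}}` (CVZ §2.4: "replacing `≥` by `≥_M`"). `Nat.sInf`, junk `0` if empty.
[cite: ChristandlVranaZuiddam2021, §2.4] -/
def monRestrictionCost (t : ι → κ → μ → K) (s : ι' → κ' → μ' → K) (n : ℕ) : ℕ :=
  sInf {m : ℕ | TensorMonRestrictsTo (kroneckerPow t m) (kroneckerPow s n)}

/-- **Monomial relative exponent** `ω_M(t,s)` (CVZ §2.4): as `relativeExponent` with `≥_M` in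
place of `≥` (again the printed limit, formalised as the infimum over `n ≥ 1`).
[cite: ChristandlVranaZuiddam2021, §2.4] -/
def monRelativeExponent (t : ι → κ → μ → K) (s : ι' → κ' → μ' → K) : ℝ :=
  ⨅ n : ℕ, (monRestrictionCost t s (n + 1) : ℝ) / ((n : ℝ) + 1)

/-- **Monomial irreversibility** `i_M(t) = ω(⟨2⟩, t) · ω_M(t, ⟨2⟩)` (CVZ §2.4, eq. before Prop. 7:
the NORMAL relative exponent from `⟨2⟩` to `t` times the MONOMIAL one from `t` to `⟨2⟩`;
`= log₂ R̃(t) / log₂ Q̃_M(t)`). [cite: ChristandlVranaZuiddam2021, §2.4] -/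
def monIrreversibility (t : ι → κ → μ → K) : ℝ :=
  relativeExponent (unitTensor K 2) t * monRelativeExponent t (unitTensor K 2)

/-- `ω_M(t,s) ≥ 0`. [folklore] -/
theorem monRelativeExponent_nonneg (t : ι → κ → μ → K) (s : ι' → κ' → μ' → K) :
    0 ≤ monRelativeExponent t s :=
  Real.iInf_nonneg fun n => by positivity


/-- A witness `t^{⊗m} ≥_M s^{⊗n}` bounds the monomial cost by `m`. [cite: ChristandlVranaZuiddam2021, §2.4] -/
theorem monRestrictionCost_le {t : ι → κ → μ → K} {s : ι' → κ' → μ' → K} {n m : ℕ}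
    (h : TensorMonRestrictsTo (kroneckerPow t m) (kroneckerPow s n)) : monRestrictionCost t s n ≤ m :=
  Nat.sInf_le h

/-- `min {m | t^{⊗m} ≥_M t^{⊗n}} ≤ n` (identity matrices). [cite: ChristandlVranaZuiddam2021, §2.4] -/
theorem monRestrictionCost_self_le [DecidableEq ι] [DecidableEq κ] [DecidableEq μ]
    (t : ι → κ → μ → K) (n : ℕ) : monRestrictionCost t t n ≤ n :=
  monRestrictionCost_le (TensorMonRestrictsTo.refl _)

/-- The terms of the infimum defining `ω_M(t,s)` are bounded below (by `0`). [folklore] -/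
theorem monRelativeExponent_bddBelow (t : ι → κ → μ → K) (s : ι' → κ' → μ' → K) :
    BddBelow (Set.range fun n : ℕ => (monRestrictionCost t s (n + 1) : ℝ) / ((n : ℝ) + 1)) :=
  ⟨0, by rintro _ ⟨n, rfl⟩; positivity⟩

/-- `ω_M(t, s) ≤ m/n` for every witness `t^{⊗m} ≥_M s^{⊗n}`, `n ≥ 1` (an upper bound on a monomial
relative exponent is certified by a single monomial restriction). [cite: ChristandlVranaZuiddam2021, §2.4] -/
theorem monRelativeExponent_le_div {t : ι → κ → μ → K} {s : ι' → κ' → μ' → K} {n m : ℕ}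
    (h : TensorMonRestrictsTo (kroneckerPow t m) (kroneckerPow s (n + 1))) :
    monRelativeExponent t s ≤ (m : ℝ) / ((n : ℝ) + 1) := by
  refine (ciInf_le (monRelativeExponent_bddBelow t s) n).trans ?_
  have hpos : (0 : ℝ) < (n : ℝ) + 1 := by positivity
  exact div_le_div_of_nonneg_right (by exact_mod_cast monRestrictionCost_le h) hpos.le

/-- `ω_M(t, t) ≤ 1`. [cite: ChristandlVranaZuiddam2021, §2.4] -/
theorem monRelativeExponent_self_le_one [DecidableEq ι] [DecidableEq κ] [DecidableEq μ]
    (t : ι → κ → μ → K) : monRelativeExponent t t ≤ 1 := by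
  have h := monRelativeExponent_le_div (t := t) (s := t) (n := 0) (m := 1)
    (TensorMonRestrictsTo.refl _)
  simpa using h

/-- `ω(t,s) ≤ m/n` from a MONOMIAL witness `t^{⊗m} ≥_M s^{⊗n}` (a monomial restriction is a
restriction; the inequality `ω ≤ ω_M` of CVZ Prop. 7 at the level of single witnesses).
[cite: ChristandlVranaZuiddam2021, Prop. 7] -/
theorem relativeExponent_le_div_of_mon {t : ι → κ → μ → K} {s : ι' → κ' → μ' → K} {n m : ℕ}
    (h : TensorMonRestrictsTo (kroneckerPow t m) (kroneckerPow s (n + 1))) :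
    relativeExponent t s ≤ (m : ℝ) / ((n : ℝ) + 1) :=
  relativeExponent_le_div h.tensorRestrictsTo

/-- `restrictionCost t s n ≤ monRestrictionCost t s n` whenever some power of `t` monomially
restricts to `s^{⊗n}` (pointwise form of `ω ≤ ω_M`, CVZ Prop. 7; the hypothesis excludes the junk
value `0` of an empty `sInf`). [cite: ChristandlVranaZuiddam2021, Prop. 7] -/
theorem restrictionCost_le_monRestrictionCost {t : ι → κ → μ → K} {s : ι' → κ' → μ' → K} {n : ℕ}
    (h : ∃ m, TensorMonRestrictsTo (kroneckerPow t m) (kroneckerPow s n)) :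
    restrictionCost t s n ≤ monRestrictionCost t s n := by
  have hne : {m : ℕ | TensorMonRestrictsTo (kroneckerPow t m) (kroneckerPow s n)}.Nonempty := h
  have hmem := Nat.sInf_mem hne
  exact restrictionCost_le (TensorMonRestrictsTo.tensorRestrictsTo hmem)

/-- `i_M(t) ≥ 0`. [folklore] -/
theorem monIrreversibility_nonneg (t : ι → κ → μ → K) : 0 ≤ monIrreversibility t :=
  mul_nonneg (relativeExponent_nonneg _ _) (monRelativeExponent_nonneg _ _)

end Monomial
end Literature.Computability.AlgebraicComplexity

end
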